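import Literature.AlgebraicGeometry.Resolution.MultisectionHyperplaneGeneric
import Literature.AlgebraicGeometry.Resolution.AlterationsMultisectionReductionLeaf
import Literature.AlgebraicGeometry.Resolution.AlterationsMultisectionEtaleNhdProofs
import Literature.AlgebraicGeometry.Resolution.AlterationsSectionDivisor
import Literature.AlgebraicGeometry.Resolution.MarkedIdeals
import Literature.AlgebraicGeometry.Resolution.FibreComponentsBaseChange
import Literature.AlgebraicGeometry.Morphisms.ProperIrreducibleInAffine
import Literature.AlgebraicGeometry.Limits.IdealSheafComap
import HarnessLib

/-!
# De Jong's multisection lemma: the hyperplane section `H` — PROVED (de Jong 1996, Lemma 4.13)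

Topic: `Literature/AlgebraicGeometry/Resolution`. Discharge of the named fact
`DeJong1996MultisectionHyperplane` (`AlterationsMultisectionLocalStep.lean`), the last named
input of de Jong's multisection lemma 4.13 and of its uses in Theorem 4.1 (4.15): the
hypersurface section `H = X ∩ V₊(G₁G₂G₃)` of `MultisectionHyperplaneGeneric.lean` satisfies
(A1)–(A4) there, and here (A5): for every geometric point `ȳ` of `Y` with `H_ȳ` reduced, every
irreducible component `C` of `X_ȳ` carries at least three points of `H` — de Jong: "being a
hyperplane section, `H_ȳ` meets every component `C`; `H` intersects `C` in at least `3` distinct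
points as soon as `deg C ≥ 3`, which holds for the embedding by `𝒪(n)`, `n ≥ 3`" (p. 70). With
three forms no degree theory is needed: `C` (a complete curve) meets each `V₊(G_j)` since
`X_ȳ ∖ V₊(G_j)` is affine (`Morphisms.inter_compl_nonempty_of_one_le_topologicalKrullDim`); if
`C ⊆ V₊(G_j)` for some `j` it carries infinitely many points of `H`; otherwise a point `z ∈ C`
common to `V₊(G₁)` and `V₊(G₂)` would give a local ring `𝒪_{H_ȳ,z} = 𝒪_{X_ȳ,z}/(g₁g₂g₃)`
which is a field (`H_ȳ` reduced and finite) with `g₁, g₂ ∈ 𝔪_z`, forcing `𝔪_z ⊆ 𝔪_z²`, `𝔪_z = 0`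
(Nakayama), i.e. `z` generic on `C` and again `C ⊆ V₊(G₁)`; so the three zero sets meet `C` in
three distinct points.

* `DeJong1996MultisectionHyperplane_holds`, and downstream `DeJong1996MultisectionLocal_holds`,
  `DeJong1996MultisectionLemma_holds`, `DeJong1996MultisectionReduction_holds` (the cascade of
  `AlterationsMultisectionEtaleNhdProofs.lean`, `AlterationsMultisectionReductionLeaf.lean`).

## References

* A. J. de Jong, *Smoothness, semi-stability and alterations*, Publ. Math. IHÉS 83 (1996),
  Lemma 4.13 (proof), pp. 69–70; 4.15, p. 71. [DeJong1996]
-/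

noncomputable section

universe u

open CategoryTheory AlgebraicGeometry Limits TopologicalSpace Opposite Topology IsLocalRing
open Literature.AlgebraicGeometry.Motives Literature.AlgebraicGeometry.Motives.Segre
  Literature.AlgebraicGeometry.Motives.GeneratingSections

attribute [local instance] MvPolynomial.gradedAlgebra

namespace Literature.AlgebraicGeometry.Resolution

/-! ### Components of a geometric fibre -/

/-- **The irreducible components of a geometric fibre `X ×_Y Spec K` have the dimension of those
of the fibre `X_y`** (`y` the image point): `X ×_Y Spec K = X_y ×_{κ(y)} Spec K`
(`topologicalKrullDim_of_mem_irreducibleComponents_of_isPullback`).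
[cite: GortzWedhorn2020, Prop. 5.38 and Exercise 5.12] -/
theorem topologicalKrullDim_of_mem_irreducibleComponents_pullback_Spec {X Y : Scheme.{u}}
    (f : X ⟶ Y) [LocallyOfFiniteType f] {K : Type u} [Field K] (yb : Spec (.of K) ⟶ Y) {d : ℕ}
    (hX : ∀ C ∈ irreducibleComponents ↥(f.fiber (yb (closedPoint K))),
      topologicalKrullDim ↥C = d)
    {C : Set ↥(pullback f yb)} (hC : C ∈ irreducibleComponents ↥(pullback f yb)) :
    topologicalKrullDim ↥C = d := by
  set y₀ := yb (closedPoint K) with hy₀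
  let φ : Y.residueField y₀ ⟶ .of K := Y.descResidueField (Scheme.stalkClosedPointTo yb)
  have hfac : Spec.map φ ≫ Y.fromSpecResidueField y₀ = yb :=
    Scheme.descResidueField_stalkClosedPointTo_fromSpecResidueField K Y yb
  let π : pullback f yb ⟶ f.fiber y₀ :=
    pullback.lift (pullback.fst f yb) (pullback.snd f yb ≫ Spec.map φ)
      (by rw [Category.assoc, hfac]; exact pullback.condition)
  have hπ1 : π ≫ f.fiberι y₀ = pullback.fst f yb := pullback.lift_fst _ _ _
  have hπ2 : π ≫ f.fiberToSpecResidueField y₀ = pullback.snd f yb ≫ Spec.map φ :=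
    pullback.lift_snd _ _ _
  have big : IsPullback (π ≫ f.fiberι y₀) (pullback.snd f yb) f
      (Spec.map φ ≫ Y.fromSpecResidueField y₀) := by
    rw [hπ1, hfac]
    exact IsPullback.of_hasPullback f yb
  have H : IsPullback π (pullback.snd f yb) (f.fiberToSpecResidueField y₀) (Spec.map φ) :=
    IsPullback.of_right big hπ2 (IsPullback.of_hasPullback f (Y.fromSpecResidueField y₀))
  haveI : LocallyOfFiniteType (f.fiberToSpecResidueField y₀) :=
    MorphismProperty.pullback_snd _ _ inferInstance
  have H' : IsPullback π (pullback.snd f yb) (f.fiberToSpecResidueField y₀)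
      (Spec.map (CommRingCat.ofHom φ.hom)) := by
    simpa using H
  exact topologicalKrullDim_of_mem_irreducibleComponents_of_isPullback (k := Y.residueField y₀)
    (L := K) φ.hom (f.fiberToSpecResidueField y₀) π (pullback.snd f yb) H' hX hC

/-- An irreducible component of dimension `1` of a Jacobson scheme (e.g. a geometric fibre of a
morphism of finite type) is infinite: a finite closed subset consists of closed points, and a
closed irreducible set of closed points is a single point. [cite: DeJong1996, Lemma 4.13 (proof), p. 70] -/
theorem infinite_of_mem_irreducibleComponents_of_topologicalKrullDim_eq_one {P : Scheme.{u}}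
    [JacobsonSpace P] {C : Set P} (hC : C ∈ irreducibleComponents P)
    (hdim : topologicalKrullDim ↥C = 1) : C.Infinite := by
  intro hfin
  have hCcl : IsClosed C := isClosed_of_mem_irreducibleComponents C hC
  obtain ⟨η, hη⟩ := QuasiSober.sober hC.1 hCcl
  have hηC : η ∈ C := hη.mem
  have hηcl : IsClosed ({η} : Set P) := isClosed_singleton_of_mem_finite hCcl hfin hηC
  have hCeq : C = {η} := by rw [← hη.def, hηcl.closure_eq]
  have h0 : topologicalKrullDim ↥C ≤ 0 :=
    Literature.AlgebraicGeometry.Morphisms.topologicalKrullDim_le_zero_of_subsingleton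
      (by rw [hCeq]; exact Set.subsingleton_singleton)
  rw [hdim] at h0
  exact absurd h0 (by decide)

/-! ### The local ring of `X_ȳ` at a common zero of two of the forms -/

section CaseB

variable {k : Type u} [Field k] {Z : SchemeOver k} {n : ℕ} (ι : Z ⟶ projectiveSpace n k)
  [IsClosedImmersion ι.left] {Y : Scheme.{u}} (f : Z.left ⟶ Y) (g : Y ⟶ Spec (.of k))

/-- **Nakayama step.** In a Noetherian local ring, if the maximal ideal is generated by a product
`a b c` with `a, b ∈ 𝔪`, then `𝔪 ⊆ 𝔪²`, so `𝔪 = 0` and the ring is a field.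
[cite: DeJong1996, Lemma 4.13 (proof), p. 70] -/
theorem isField_of_maximalIdeal_eq_span_mul {R : Type*} [CommRing R] [IsLocalRing R]
    [IsNoetherianRing R] {a b c : R} (ha : a ∈ maximalIdeal R) (hb : b ∈ maximalIdeal R)
    (h : maximalIdeal R = Ideal.span {a * b * c}) : IsField R := by
  rw [IsLocalRing.isField_iff_maximalIdeal_eq]
  refine Submodule.eq_bot_of_le_smul_of_le_jacobson_bot (maximalIdeal R) (maximalIdeal R)
    (IsNoetherian.noetherian _) ?_ (IsLocalRing.maximalIdeal_le_jacobson _)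
  rw [Ideal.smul_eq_mul]
  conv_lhs => rw [h]
  rw [Ideal.span_singleton_le_iff_mem]
  exact Ideal.mul_mem_right _ _ (Ideal.mul_mem_mul ha hb)

/-- **A point with field local ring is generic on every irreducible component through it**, so
such a component lies in every closed set containing the point. [folklore] -/
private theorem subset_of_isField_stalk {P : Scheme.{u}} {z : P}
    (hF : IsField (P.presheaf.stalk z)) {C : Set P} (hC : C ∈ irreducibleComponents P)
    (hzC : z ∈ C) {T : Set P} (hT : IsClosed T) (hzT : z ∈ T) : C ⊆ T := by
  have hdim : ringKrullDim (P.presheaf.stalk z) = 0 := ringKrullDim_eq_zero_of_isField hF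
  rw [ringKrullDim_stalk_eq_coheight z] at hdim
  have hmax : IsMax z := by
    rw [← Order.coheight_eq_zero]
    exact_mod_cast hdim
  obtain ⟨η, hη⟩ := QuasiSober.sober hC.1 (isClosed_of_mem_irreducibleComponents C hC)
  have hηz : η ⤳ z := hη.specializes hzC
  have hzη : z ⤳ η := Scheme.le_iff_specializes.mp (hmax (Scheme.le_iff_specializes.mpr hηz))
  have hηT : η ∈ T := hT.closure_subset_iff.mpr (Set.singleton_subset_iff.mpr hzT)
    (specializes_iff_mem_closure.mp hzη)
  rw [← hη.def]
  exact hT.closure_subset_iff.mpr (Set.singleton_subset_iff.mpr hηT)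

/-- **Case B of the point count.** Let `H = X ∩ V₊(G₁G₂G₃)` with `f|_H` finite, `ȳ : Spec K → Y`
a geometric point with `H_ȳ = H ×_Y Spec K` reduced, and `z ∈ X_ȳ = X ×_Y Spec K` a point whose
image in `X` is a common zero of `G₁` and `G₂`. Then `𝒪_{X_ȳ,z}` is a field: `𝒪_{H_ȳ,z}` is a
field (`H_ȳ` is finite and reduced over `K`, hence discrete and reduced) and equals
`𝒪_{X_ȳ,z}/(g₁g₂g₃)` with `g₁, g₂ ∈ 𝔪_z`, so `𝔪_z = (g₁g₂g₃) ⊆ 𝔪_z²` and `𝔪_z = 0` by Nakayama.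
[cite: DeJong1996, Lemma 4.13 (proof), p. 70] -/
theorem isField_stalk_pullback_of_mem_support [IsSeparated g] [LocallyOfFiniteType f]
    [QuasiSeparatedSpace Z.left] {m : ℕ}
    (G₁ G₂ G₃ : MvPolynomial (Fin (n + 1)) k) (h₁ : G₁.IsHomogeneous m) (h₂ : G₂.IsHomogeneous m)
    (h₃ : G₃.IsHomogeneous m)
    [IsFinite (((ofHom (emb ι)).secOfForm Z.hom (G₁ * G₂ * G₃)
      ((h₁.mul h₂).mul h₃)).zeroIdeal.subschemeι ≫ f)]
    {K : Type u} [Field K] (yb : Spec (.of K) ⟶ Y)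
    (hred : IsReduced (pullback (((ofHom (emb ι)).secOfForm Z.hom (G₁ * G₂ * G₃)
      ((h₁.mul h₂).mul h₃)).zeroIdeal.subschemeι ≫ f) yb))
    {z : ↥(pullback f yb)}
    (hz1 : pullback.fst f yb z ∈
      (((ofHom (emb ι)).secOfForm Z.hom G₁ h₁).zeroIdeal.support : Set Z.left))
    (hz2 : pullback.fst f yb z ∈
      (((ofHom (emb ι)).secOfForm Z.hom G₂ h₂).zeroIdeal.support : Set Z.left)) :
    IsField ((pullback f yb).presheaf.stalk z) := by
  haveI : IsClosedImmersion (emb ι) := ‹_›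
  have hUaff := isAffineOpen_ofHom_U (emb ι)
  haveI : LocallyOfFiniteType (pullback.snd f yb) := MorphismProperty.pullback_snd _ _ inferInstance
  haveI : IsLocallyNoetherian (pullback f yb) :=
    LocallyOfFiniteType.isLocallyNoetherian (pullback.snd f yb)
  -- the ideal sheaf of `H`, and `H_ȳ` as the closed subscheme `V(I·𝒪_{X_ȳ})` of `X_ȳ`
  obtain ⟨I, hI⟩ : ∃ I : Z.left.IdealSheafData, I = ((ofHom (emb ι)).secOfForm Z.hom
      (G₁ * G₂ * G₃) ((h₁.mul h₂).mul h₃)).zeroIdeal := ⟨_, rfl⟩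
  haveI : IsFinite (I.subschemeι ≫ f) := by rw [hI]; infer_instance
  have hred' : IsReduced (pullback (I.subschemeι ≫ f) yb) := by rw [hI]; exact hred
  let e : (I.comap (pullback.fst f yb)).subscheme ≅ pullback (I.subschemeι ≫ f) yb :=
    I.comapIso (pullback.fst f yb) ≪≫ pullbackSymmetry _ _ ≪≫
      pullbackRightPullbackFstIso f yb I.subschemeι
  haveI : IsReduced (I.comap (pullback.fst f yb)).subscheme := isReduced_of_isOpenImmersion e.hom
  have he : (I.comap (pullback.fst f yb)).subschemeι ≫ pullback.snd f yb =
      e.hom ≫ pullback.snd (I.subschemeι ≫ f) yb := by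
    simp only [e, Iso.trans_hom, Category.assoc, pullbackRightPullbackFstIso_hom_snd,
      pullbackSymmetry_hom_comp_snd_assoc, Scheme.IdealSheafData.comapIso_hom_fst_assoc]
  haveI : IsFinite (pullback.snd (I.subschemeι ≫ f) yb) := MorphismProperty.pullback_snd _ _ ‹_›
  haveI : IsFinite ((I.comap (pullback.fst f yb)).subschemeι ≫ pullback.snd f yb) := by
    rw [he]; infer_instance
  haveI : DiscreteTopology ↥(I.comap (pullback.fst f yb)).subscheme := by
    have hd := ((I.comap (pullback.fst f yb)).subschemeι ≫ pullback.snd f yb)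
      |>.isDiscrete_preimage_singleton (closedPoint K)
    rw [← isDiscrete_univ_iff]
    convert hd using 1
    exact (Set.eq_univ_of_forall fun w => (Subsingleton.elim _ _ :
      ((I.comap (pullback.fst f yb)).subschemeι ≫ pullback.snd f yb) w = closedPoint K)).symm
  -- `z` lies on `H_ȳ`: `z = j(w)`
  have hzI : pullback.fst f yb z ∈ (I.support : Set Z.left) := by
    rw [hI, mem_support_zeroIdeal_secOfForm_mul_iff ι (G₁ * G₂) G₃ (h₁.mul h₂) h₃,
      mem_support_zeroIdeal_secOfForm_mul_iff ι G₁ G₂ h₁ h₂]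
    exact Or.inl (Or.inl hz1)
  obtain ⟨w, hw⟩ : z ∈ Set.range (I.comap (pullback.fst f yb)).subschemeι := by
    rw [Scheme.IdealSheafData.range_subschemeι, Scheme.IdealSheafData.support_comap]
    exact hzI
  subst hw
  -- `𝒪_{H_ȳ,w}` is a field, and it is `𝒪_{X_ȳ,z} / I_z`; so `I_z = 𝔪_z`
  have hF : IsField ((I.comap (pullback.fst f yb)).subscheme.presheaf.stalk w) :=
    isField_stalk_of_discreteTopology w
  have hker : RingHom.ker ((I.comap (pullback.fst f yb)).subschemeι.stalkMap w).hom =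
      stalkIdeal (I.comap (pullback.fst f yb)) ((I.comap (pullback.fst f yb)).subschemeι w) := by
    rw [← stalkIdeal_ker_eq_ker_stalkMap (I.comap (pullback.fst f yb)).subschemeι w,
      Scheme.IdealSheafData.ker_subschemeι]
  have hF' : IsField ((pullback f yb).presheaf.stalk ((I.comap (pullback.fst f yb)).subschemeι w) ⧸
      stalkIdeal (I.comap (pullback.fst f yb)) ((I.comap (pullback.fst f yb)).subschemeι w)) := by
    rw [← hker]
    exact MulEquiv.isField hF (RingHom.quotientKerEquivOfSurjective
      ((I.comap (pullback.fst f yb)).subschemeι.stalkMap_surjective w)).toMulEquiv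
  have hmax : stalkIdeal (I.comap (pullback.fst f yb)) ((I.comap (pullback.fst f yb)).subschemeι w) =
      maximalIdeal _ :=
    IsLocalRing.eq_maximalIdeal (Ideal.Quotient.maximal_of_isField _ hF')
  -- a chart: `pr z ∈ X_i = r⁻¹D₊(x_i)`, `V = pr⁻¹ X_i` affine; the ring map `ρ : k[x] → 𝒪_{X_ȳ,z}`
  obtain ⟨i, hzi⟩ : ∃ i, pullback.fst f yb ((I.comap (pullback.fst f yb)).subschemeι w) ∈
      (ofHom (emb ι)).U i := by
    have h : pullback.fst f yb ((I.comap (pullback.fst f yb)).subschemeι w) ∈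
        (⨆ i, (ofHom (emb ι)).U i : Z.left.Opens) := by
      rw [(ofHom (emb ι)).iSup_U]; trivial
    exact Opens.mem_iSup.mp h
  have hVaff : IsAffineOpen ((pullback.fst f yb) ⁻¹ᵁ (ofHom (emb ι)).U i) :=
    Literature.AlgebraicGeometry.Morphisms.isAffineOpen_preimage_pullback_fst f yb g (hUaff i)
  have hzV : (I.comap (pullback.fst f yb)).subschemeι w ∈
      (pullback.fst f yb) ⁻¹ᵁ (ofHom (emb ι)).U i := hzi
  obtain ⟨ρ, hρ⟩ : ∃ ρ : MvPolynomial (Fin (n + 1)) k →+*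
      (pullback f yb).presheaf.stalk ((I.comap (pullback.fst f yb)).subschemeι w),
      ρ = ((pullback f yb).presheaf.germ _ _ hzV).hom.comp
        (((pullback.fst f yb).appLE ((ofHom (emb ι)).U i)
          ((pullback.fst f yb) ⁻¹ᵁ (ofHom (emb ι)).U i) le_rfl).hom.comp
          ((ofHom (emb ι)).sectionsFun Z.hom i)) := ⟨_, rfl⟩
  have hJV : (I.comap (pullback.fst f yb)).ideal ⟨_, hVaff⟩ = Ideal.span
      {((pullback.fst f yb).appLE ((ofHom (emb ι)).U i)
          ((pullback.fst f yb) ⁻¹ᵁ (ofHom (emb ι)).U i) le_rfl).hom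
        ((ofHom (emb ι)).sectionsFun Z.hom i (G₁ * G₂ * G₃))} := by
    rw [Literature.AlgebraicGeometry.Limits.ideal_comap_eq_map (pullback.fst f yb) I
      ⟨(ofHom (emb ι)).U i, hUaff i⟩ ⟨_, hVaff⟩ rfl, hI, Sec.ideal_zeroIdeal_self _ hUaff i,
      secOfForm_val, Ideal.map_span, Set.image_singleton]
  have hstalk : stalkIdeal (I.comap (pullback.fst f yb))
      ((I.comap (pullback.fst f yb)).subschemeι w) = Ideal.span {ρ G₁ * ρ G₂ * ρ G₃} := by
    rw [← map_mul, ← map_mul, stalkIdeal_eq_map_germ _ ⟨_, hVaff⟩ hzV, hJV, Ideal.map_span,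
      Set.image_singleton, hρ]
    rfl
  -- `ρ(G_j) ∈ 𝔪_z` for `j = 1, 2`
  have hmem : ∀ (G : MvPolynomial (Fin (n + 1)) k) (hG : G.IsHomogeneous m),
      pullback.fst f yb ((I.comap (pullback.fst f yb)).subschemeι w) ∈
        (((ofHom (emb ι)).secOfForm Z.hom G hG).zeroIdeal.support : Set Z.left) →
        ρ G ∈ maximalIdeal _ := by
    intro G hG hzG
    rw [SetLike.mem_coe, ((ofHom (emb ι)).secOfForm Z.hom G hG).mem_support_zeroIdeal_iff hUaff
      hzi, secOfForm_val] at hzG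
    rw [IsLocalRing.mem_maximalIdeal, mem_nonunits_iff, hρ, RingHom.comp_apply,
      RingHom.comp_apply, ← Scheme.mem_basicOpen, Scheme.basicOpen_appLE, Opens.mem_inf, not_and]
    exact fun _ => hzG
  exact isField_of_maximalIdeal_eq_span_mul (hmem G₁ h₁ hz1) (hmem G₂ h₂ hz2)
    (hmax.symm.trans hstalk)

end CaseB

/-! ### (A5) and the assembly -/

section Assembly

variable {k : Type u} [Field k] {Z : SchemeOver k} {n : ℕ}
  (ι : Z ⟶ projectiveSpace n k) [IsClosedImmersion ι.left] {Y : Scheme.{u}} (f : Z.left ⟶ Y)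
  (g : Y ⟶ Spec (.of k))

/-- **(A5): three points of `H` on every component of every geometric fibre.** For
`H = X ∩ V₊(G₁G₂G₃)` (forms of positive degree) with `f|_H` finite, `f` proper and the fibres
of `f` with components of dimension `1`: if `H_ȳ` is reduced, every irreducible component `C`
of `X_ȳ` contains at least three points mapping to `H`. [cite: DeJong1996, Lemma 4.13 (proof), p. 70] -/
theorem three_le_encard_inter_preimage_support [IsSeparated g] [IsProper f]
    [QuasiSeparatedSpace Z.left]
    (hdim : ∀ (y : Y), ∀ C ∈ irreducibleComponents ↥(f.fiber y), topologicalKrullDim ↥C = 1)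
    {m : ℕ} (hm : 0 < m)
    (G₁ G₂ G₃ : MvPolynomial (Fin (n + 1)) k) (h₁ : G₁.IsHomogeneous m) (h₂ : G₂.IsHomogeneous m)
    (h₃ : G₃.IsHomogeneous m)
    [IsFinite (((ofHom (emb ι)).secOfForm Z.hom (G₁ * G₂ * G₃)
      ((h₁.mul h₂).mul h₃)).zeroIdeal.subschemeι ≫ f)]
    (K : Type u) [Field K] [IsAlgClosed K] (yb : Spec (.of K) ⟶ Y)
    (hred : IsReduced (pullback (((ofHom (emb ι)).secOfForm Z.hom (G₁ * G₂ * G₃)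
      ((h₁.mul h₂).mul h₃)).zeroIdeal.subschemeι ≫ f) yb))
    (C : Set ↥(pullback f yb)) (hC : C ∈ irreducibleComponents ↥(pullback f yb)) :
    3 ≤ (C ∩ (pullback.fst f yb) ⁻¹' ((((ofHom (emb ι)).secOfForm Z.hom (G₁ * G₂ * G₃)
      ((h₁.mul h₂).mul h₃)).zeroIdeal.support : Set Z.left))).encard := by
  haveI : IsClosedImmersion (emb ι) := ‹_›
  haveI : IsProper (pullback.snd f yb) := MorphismProperty.pullback_snd _ _ inferInstance
  haveI : JacobsonSpace ↥(pullback f yb) := LocallyOfFiniteType.jacobsonSpace (pullback.snd f yb)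
  have hCcl : IsClosed C := isClosed_of_mem_irreducibleComponents C hC
  have hdimC : topologicalKrullDim ↥C = 1 :=
    topologicalKrullDim_of_mem_irreducibleComponents_pullback_Spec f yb (hdim _) hC
  -- the zero sets transported: `V(ABD) = V(G₁G₂G₃)` for a permutation `(A, B, D)` of the forms
  have hperm : ∀ {F F' : MvPolynomial (Fin (n + 1)) k} (hF : F.IsHomogeneous (m + m + m))
      (hF' : F'.IsHomogeneous (m + m + m)), F = F' →
        ((ofHom (emb ι)).secOfForm Z.hom F hF).zeroIdeal =
          ((ofHom (emb ι)).secOfForm Z.hom F' hF').zeroIdeal := by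
    rintro F F' hF hF' rfl
    rfl
  have hsupp : ∀ x : Z.left, x ∈ ((((ofHom (emb ι)).secOfForm Z.hom (G₁ * G₂ * G₃)
      ((h₁.mul h₂).mul h₃)).zeroIdeal.support : Set Z.left)) ↔
      x ∈ (((ofHom (emb ι)).secOfForm Z.hom G₁ h₁).zeroIdeal.support : Set Z.left) ∨
      x ∈ (((ofHom (emb ι)).secOfForm Z.hom G₂ h₂).zeroIdeal.support : Set Z.left) ∨
      x ∈ (((ofHom (emb ι)).secOfForm Z.hom G₃ h₃).zeroIdeal.support : Set Z.left) := by
    intro x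
    rw [mem_support_zeroIdeal_secOfForm_mul_iff ι (G₁ * G₂) G₃ (h₁.mul h₂) h₃,
      mem_support_zeroIdeal_secOfForm_mul_iff ι G₁ G₂ h₁ h₂, or_assoc]
  -- each `V₊(G_j)` meets `C`: its complement in `X_ȳ` is affine and `C` is a complete curve
  have hmeet : ∀ (G : MvPolynomial (Fin (n + 1)) k) (hG : G.IsHomogeneous m),
      ∃ z ∈ C, pullback.fst f yb z ∈
        (((ofHom (emb ι)).secOfForm Z.hom G hG).zeroIdeal.support : Set Z.left) := by
    intro G hG
    have hUaff : IsAffineOpen ((pullback.fst f yb) ⁻¹ᵁ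
        ((emb ι) ⁻¹ᵁ Proj.basicOpen (grading (Fin (n + 1)) k) G)) :=
      Literature.AlgebraicGeometry.Morphisms.isAffineOpen_preimage_pullback_fst f yb g
        (isAffineOpen_preimage_basicOpen (emb ι) hm G hG)
    obtain ⟨z, hzC, hzU⟩ :=
      Literature.AlgebraicGeometry.Morphisms.inter_compl_nonempty_of_one_le_topologicalKrullDim
        (pullback.snd f yb) hC.1 hCcl (by rw [hdimC]) hUaff
    refine ⟨z, hzC, ?_⟩
    rw [support_zeroIdeal_secOfForm_ofHom Z.hom (emb ι) (emb_toSpec ι) hm G hG]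
    exact hzU
  -- Case A: `C ⊆ pr⁻¹(H)` — infinitely many points
  by_cases hA : C ⊆ (pullback.fst f yb) ⁻¹' ((((ofHom (emb ι)).secOfForm Z.hom (G₁ * G₂ * G₃)
      ((h₁.mul h₂).mul h₃)).zeroIdeal.support : Set Z.left))
  · rw [Set.inter_eq_self_of_subset_left hA, Set.Infinite.encard_eq
      (infinite_of_mem_irreducibleComponents_of_topologicalKrullDim_eq_one hC hdimC)]
    exact le_top
  -- Case B: the zero sets of `G₁, G₂, G₃` meet `C` in three distinct points
  obtain ⟨z₁, hz₁C, hz₁⟩ := hmeet G₁ h₁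
  obtain ⟨z₂, hz₂C, hz₂⟩ := hmeet G₂ h₂
  obtain ⟨z₃, hz₃C, hz₃⟩ := hmeet G₃ h₃
  -- if a point of `C` were a common zero of two of the forms, `C ⊆ V₊` of the first of them
  have key : ∀ {A B D : MvPolynomial (Fin (n + 1)) k} (hA' : A.IsHomogeneous m)
      (hB : B.IsHomogeneous m) (hD : D.IsHomogeneous m) (habd : A * B * D = G₁ * G₂ * G₃)
      {z : ↥(pullback f yb)}, z ∈ C →
        pullback.fst f yb z ∈
          (((ofHom (emb ι)).secOfForm Z.hom A hA').zeroIdeal.support : Set Z.left) →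
        pullback.fst f yb z ∈
          (((ofHom (emb ι)).secOfForm Z.hom B hB).zeroIdeal.support : Set Z.left) → False := by
    intro A B D hA' hB hD habd z hzC hzA hzB
    have e := hperm ((hA'.mul hB).mul hD) ((h₁.mul h₂).mul h₃) habd
    haveI : IsFinite (((ofHom (emb ι)).secOfForm Z.hom (A * B * D)
        ((hA'.mul hB).mul hD)).zeroIdeal.subschemeι ≫ f) := by rw [e]; infer_instance
    have hred' : IsReduced (pullback (((ofHom (emb ι)).secOfForm Z.hom (A * B * D)
        ((hA'.mul hB).mul hD)).zeroIdeal.subschemeι ≫ f) yb) := by rw [e]; exact hred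
    have hFz := isField_stalk_pullback_of_mem_support ι f g A B D hA' hB hD yb hred' hzA hzB
    refine hA ((subset_of_isField_stalk hFz hC hzC
      ((((ofHom (emb ι)).secOfForm Z.hom A hA').zeroIdeal.support).isClosed.preimage
        (pullback.fst f yb).continuous) hzA).trans fun x hx => ?_)
    -- `V₊(A) ⊆ V₊(ABD) = V₊(G₁G₂G₃)`
    show x ∈ (pullback.fst f yb) ⁻¹' _
    rw [Set.mem_preimage, ← e, SetLike.mem_coe, ← SetLike.mem_coe,
      mem_support_zeroIdeal_secOfForm_mul_iff ι (A * B) D (hA'.mul hB) hD,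
      mem_support_zeroIdeal_secOfForm_mul_iff ι A B hA' hB]
    exact Or.inl (Or.inl hx)
  have h12 : z₁ ≠ z₂ := fun h => key h₁ h₂ h₃ rfl hz₁C hz₁ (h ▸ hz₂)
  have h13 : z₁ ≠ z₃ := fun h => key h₁ h₃ h₂ (by ring) hz₁C hz₁ (h ▸ hz₃)
  have h23 : z₂ ≠ z₃ := fun h => key h₂ h₃ h₁ (by ring) hz₂C hz₂ (h ▸ hz₃)
  have h3 : ({z₁, z₂, z₃} : Set ↥(pullback f yb)) ⊆ C ∩ (pullback.fst f yb) ⁻¹'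
      ((((ofHom (emb ι)).secOfForm Z.hom (G₁ * G₂ * G₃)
        ((h₁.mul h₂).mul h₃)).zeroIdeal.support : Set Z.left)) := by
    intro z hz
    simp only [Set.mem_insert_iff, Set.mem_singleton_iff] at hz
    rcases hz with rfl | rfl | rfl
    · exact ⟨hz₁C, (hsupp _).mpr (Or.inl hz₁)⟩
    · exact ⟨hz₂C, (hsupp _).mpr (Or.inr (Or.inl hz₂))⟩
    · exact ⟨hz₃C, (hsupp _).mpr (Or.inr (Or.inr hz₃))⟩
  calc (3 : ℕ∞) = ({z₁, z₂, z₃} : Set ↥(pullback f yb)).encard :=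
        (Set.encard_eq_three.mpr ⟨z₁, z₂, z₃, h12, h13, h23, rfl⟩).symm
    _ ≤ _ := Set.encard_le_encard h3

/-! ### The named fact -/

/-- **de Jong 1996, proof of Lemma 4.13 — the hyperplane section `H`, PROVED**: the named fact
`DeJong1996MultisectionHyperplane`. Given the data of 4.13 and a closed point `y`, the effective
Cartier divisor `H = X ∩ V₊(G₁G₂G₃)` of `exists_generic_hypersurface_section` (three generic
forms) satisfies (A1)–(A4) there and (A5) by `three_le_encard_inter_preimage_support`.
[cite: DeJong1996, Lemma 4.13 (proof), pp. 69–70] -/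
theorem DeJong1996MultisectionHyperplane_holds : DeJong1996MultisectionHyperplane.{u} := by
  intro k _ _ X Y _ _ f _ g hX hY hsurj _ hdim hdense y hy
  obtain ⟨n, ι, hι⟩ := hX
  haveI : IsClosedImmersion ι.left := hι
  haveI : IsProper (projectiveSpace n k).hom := isProper_projectiveSpace n k
  haveI : IsProper (Over.mk (f ≫ g) : SchemeOver k).hom := by rw [← Over.w ι]; infer_instance
  haveI : IsProper (f ≫ g) := ‹IsProper (Over.mk (f ≫ g) : SchemeOver k).hom›
  haveI : IsProper g := IsProjectiveOver.isProper (X := Over.mk g) hY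
  haveI : IsProper f := IsProper.of_comp f g
  -- instances on `Z.left = X` for `Z = (X → Spec k)` (instance synthesis does not unfold
  -- `Over.mk`, so they are restated at the type `(Over.mk (f ≫ g)).left`)
  haveI : IsIntegral (Over.mk (f ≫ g) : SchemeOver k).left := ‹IsIntegral X›
  haveI : QuasiSeparatedSpace (Over.mk (f ≫ g) : SchemeOver k).left :=
    (quasiSeparatedSpace_of_quasiSeparated (f ≫ g) : QuasiSeparatedSpace X)
  haveI : LocallyOfFinitePresentation (X := (Over.mk (f ≫ g) : SchemeOver k).left) f :=
    ‹LocallyOfFinitePresentation f›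
  haveI : IsProper (X := (Over.mk (f ≫ g) : SchemeOver k).left) f := ‹IsProper f›
  obtain ⟨m, hm, G₁, G₂, G₃, h₁, h₂, h₃, I, hI, hA1, hA2, hA3, hA4, hfin⟩ :=
    exists_generic_hypersurface_section ι f g rfl hY hsurj hdim hdense y hy
  refine ⟨I, hA1, hA2, hA3, hA4, fun K _ _ yb hred C hC => ?_⟩
  subst hI
  exact three_le_encard_inter_preimage_support ι f g hdim hm G₁ G₂ G₃ h₁ h₂ h₃ K yb hred C hC

end Assembly

/-! ### Downstream: Lemma 4.13 and the reduction of Theorem 4.1, unconditionally -/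

/-- **de Jong 1996, Lemma 4.13, local form — PROVED.** [cite: DeJong1996, Lemma 4.13, pp. 69–70] -/
theorem DeJong1996MultisectionLocal_holds : DeJong1996MultisectionLocal.{u} :=
  DeJong1996MultisectionLocal.of_hyperplane DeJong1996MultisectionHyperplane_holds

/-- **de Jong 1996, Lemma 4.13 — PROVED.** [cite: DeJong1996, Lemma 4.13, pp. 69–70] -/
theorem DeJong1996MultisectionLemma_holds : DeJong1996MultisectionLemma.{u} :=
  DeJong1996MultisectionLemma.of_hyperplane DeJong1996MultisectionHyperplane_holds

/-- **de Jong 1996, 4.15: the reduction of Theorem 4.1 to the situation 4.16 — PROVED.**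
[cite: DeJong1996, 4.15, p. 71] -/
theorem DeJong1996MultisectionReduction_holds : DeJong1996MultisectionReduction.{u} :=
  DeJong1996MultisectionReduction.of_hyperplane DeJong1996MultisectionHyperplane_holds

end Literature.AlgebraicGeometry.Resolution

end
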